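/-
Copyright (c) 2026. All rights reserved.
Released under Apache 2.0 license as described in the file LICENSE.
Authors: abc-iut cell, statement-typer seat abc-iut-L4-t3 (wave 1).
-/
import Mathlib.Topology.Algebra.Category.ProfiniteGrp.Basic
import Mathlib.Topology.Algebra.Group.ClosedSubgroup
import Mathlib.GroupTheory.Commutator.Basic
import Mathlib.Analysis.Complex.Basic
import Literature.AnabelianGeometry.AbsoluteAnabelian.FundamentalExtension
import Literature.AnabelianGeometry.AbsoluteAnabelian.LogShells
import HarnessLib

/-!
# [AbsTopIII] Definition 5.6 (i) and Proposition 5.8 (i)–(vi): mono-analytic reconstruction of log-shells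

S. Mochizuki, *Topics in absolute anabelian geometry III: global reconstruction algorithms*,
J. Math. Sci. Univ. Tokyo 22 (2015) 939–1156 [MochizukiAbsTopIII2015]; locators `p.N` = pages of the
author's manuscript (`paper:url-5493eb38cbb7`, 164 pp; journal pagination not held), read on the page:
Def 5.6 (i) pp. 133–134, Prop 5.8 (i)–(iii) pp. 139–140, (iv)–(vi) pp. 140–141, Def 5.9 (i) p. 143.

## What is typed and how

Prop 5.8 asserts FUNCTORIAL "GROUP-THEORETIC" ALGORITHMS `G ↦ (…)` on the categories `TG⊢` (profinite
groups isomorphic to the absolute Galois group of an MLF, open injections) and `TM⊢` (topological monoids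
isomorphic to `𝒪_ℂ^▷` with a submonoid `≅ ℝ_{≥0}`) of Def 5.6 (i). Per the layer policy
(plan/L4/ASSIGNMENTS.md §2, FOUNDATIONS row 41) such an algorithm is typed as DATA INDEXED BY THE ABSTRACT
GROUP/MONOID — here the structures `MonoAnalyticNonarch G` (outputs of (i)–(iii): the invariants
`p, f, e, m` (`MLFType`), the images of `𝒪_k^▷`, `k^×` in `G^ab`, the `Γ⃗×_non`-diagram
`𝒪^×_k̄(G) ↪ k̄^×(G) → (k̄^×)^pf(G) ⊇ k~(G)`, the log-shell `ℐ(G) ⊆ k~(G)^G`, the line `R_non(G)` with its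
Frobenius element and the log-volume `μ^log(G)` with the printed normalisation) and `MonoAnalyticArch G`
(outputs of (iv)–(vi): `C~`, `k~(G) = C~ × C~`, `Seg(G)`, `R_arc(G)`, `F(G) ↔ 2π`, `ℐ(G)`, `𝒪^×_{k~(G)}`,
radial/angular log-volumes with the printed normalisation) — whose fields QUOTE PRINT; the EXISTENCE and
FUNCTORIALITY of the algorithm and its agreement with the field-theoretic objects when `G = G_k` are
the hypothesis structures `MonoAnalyticNonarchAlgorithm`, `MonoAnalyticArchAlgorithm` (interfaces to be
instantiated by abc-iut-L4-t4's [AbsAnab] Prop 1.2.1 / LCFT facts and abc-iut-L4-t2's Def 3.1 / 4.1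
categories — TODO-merge abc-iut-L4-t4, abc-iut-L4-t2). "[Orbi-]topological groups isomorphic to `ℝ`
equipped with a distinguished element" (`R_non`, `R_arc`, and `R_v`, `R_⊚V` of Def 5.9 (i)) are modelled by
`RLine` = a rank-one real vector space with a nonzero vector (equivalent data: a topological group `≅ ℝ`
carries a unique compatible `ℝ`-line structure, and "division by a positive real number is well-defined",
Def 5.9 (i)). The numerical content (`MLFType`, `p*`, the coefficient `-1 - m/f + e·log p*/log p`, the
`ℂ`-model of `ℐ`, `𝒪^×_{k~}`) is in `LogShells.lean` and is reused, not restated.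

NOT here: Prop 5.8 (ii)'s ambient categories `C^{MLF⊢}_{TS⊞}` and (v)'s `C^{hol⊢}_{TB⊞}` (abc-iut-L4-t2's
Def 3.1 (iii) / 4.1 (iii) and Def 5.6 (iii)–(iv)); Prop 5.8 (vii) and Def 5.6 (ii)–(iv) (mono-analytic
Galois-theaters; sibling file); `TB⊞`, `TB` of Def 5.6 (i) (sibling file, with (vii)). Refereed pre-IUT
anabelian geometry; nothing here bears on [IUTchIII] Cor. 3.12; typed ≠ discharged.
-/

set_option autoImplicit false

universe u

open Topology
open scoped Pointwise

namespace Literature.AnabelianGeometry.AbsoluteAnabelian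

/-! ## Lines `≅ ℝ` with a distinguished element -/

/-- "A(n) [orbi-]topological group isomorphic to `ℝ` equipped with a distinguished element" (Prop 5.8 (iii),
(vi); Def 5.9 (i)), modelled as a rank-one real vector space with a nonzero vector `frob` (the *Frobenius
element*); "division of elements by a positive real number is well-defined" (Def 5.9 (i)).
[cite: MochizukiAbsTopIII2015, Prop 5.8 (iii) p. 140] -/
structure RLine : Type (u + 1) where
  /-- the underlying group -/
  carrier : Type u
  /-- additive group structure -/
  [instAddCommGroup : AddCommGroup carrier]
  /-- real line structure -/
  [instModule : Module ℝ carrier]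
  /-- the distinguished (Frobenius) element -/
  frob : carrier
  /-- it is nonzero -/
  frob_ne_zero : frob ≠ 0
  /-- rank one: every element is a real multiple of `frob` -/
  exists_eq_smul : ∀ x : carrier, ∃ r : ℝ, x = r • frob

attribute [instance] RLine.instAddCommGroup RLine.instModule

namespace RLine

variable (L : RLine.{u})

/-- the coordinate of `x` relative to `frob` (`x = coord x • frob`).
[cite: MochizukiAbsTopIII2015, Def 5.9 (i) p. 143] -/
noncomputable def coord (x : L.carrier) : ℝ := Classical.choose (L.exists_eq_smul x)

/-- `x = coord x • frob`. [cite: MochizukiAbsTopIII2015, Def 5.9 (i) p. 143] -/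
theorem coord_smul_frob (x : L.carrier) : L.coord x • L.frob = x :=
  (Classical.choose_spec (L.exists_eq_smul x)).symm

/-- the isomorphism `R ≅ ℝ` "given by `c ↦ F`" read backwards: `x ↦ coord(x) · c` (e.g. `c = f_G·log p_G` for
`R_non(G)`, `c = 2π` for `R_arc(G)`). [cite: MochizukiAbsTopIII2015, Prop 5.8 (iii) p. 140] -/
noncomputable def toReal (c : ℝ) (x : L.carrier) : ℝ := L.coord x * c

end RLine

/-! ## Def 5.6 (i): the categories `TG⊢`, `TM⊢` -/

/-- `Ob(TG⊢)`: "the profinite groups isomorphic to the absolute Galois group of an MLF" (morphisms of `TG⊢`: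
open injections of profinite groups). [cite: MochizukiAbsTopIII2015, Def 5.6 (i) p. 134] -/
def IsMLFGaloisType (G : ProfiniteGrp.{u}) : Prop :=
  ∃ (k : Type u) (_ : Field k) (_ : CharZero k), IsMLF k ∧ Nonempty (G ≃ₜ* absoluteGaloisGrp k)

/-- a morphism of `TG⊢` (and of `TG`): an open injection of profinite groups.
[cite: MochizukiAbsTopIII2015, Def 5.6 (i) p. 134] -/
structure IsOpenInjection {G H : ProfiniteGrp.{u}} (f : G →ₜ* H) : Prop where
  /-- injective -/
  injective : Function.Injective f
  /-- with open image -/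
  isOpen_range : IsOpen (Set.range f)

/-- `𝒪_ℂ^▷ = 𝒪_ℂ ∖ {0} = {z : 0 < ‖z‖ ≤ 1}`, the multiplicative topological monoid of nonzero integral
elements of the complex archimedean field. [cite: MochizukiAbsTopIII2015, Def 5.6 (i) p. 134] -/
def complexIntegralMonoid : Submonoid ℂ where
  carrier := {z | 0 < ‖z‖ ∧ ‖z‖ ≤ 1}
  one_mem' := by simp
  mul_mem' := by
    rintro a b ⟨ha0, ha1⟩ ⟨hb0, hb1⟩
    refine ⟨by rw [norm_mul]; positivity, ?_⟩
    rw [norm_mul]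
    exact mul_le_one₀ ha1 (norm_nonneg b) hb1

/-- `Ob(TM⊢)`: pairs `(C, C⃗)` of a topological monoid `C` isomorphic to `𝒪_ℂ^▷` and a topological submonoid
`C⃗ ⊆ C` "[necessarily isomorphic to `ℝ_{≥0}`] such that the natural inclusions `C^× ↪ C`, `C⃗ ↪ C` determine
an isomorphism `C^× × C⃗ ≅ C` of topological monoids" (the submonoid is NOT required to correspond to
`ℝ_{>0} ∩ 𝒪_ℂ^▷`: it is "non-rigid … subject to dilations", Rmk 5.8.1 (i)). Morphisms: isomorphisms of
topological monoids `C₁ ≅ C₂` inducing `C⃗₁ ≅ C⃗₂`. [cite: MochizukiAbsTopIII2015, Def 5.6 (i) p. 134] -/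
structure TMMono : Type (u + 1) where
  /-- the topological monoid `C` -/
  C : Type u
  /-- monoid structure -/
  [instMonoid : CommMonoid C]
  /-- topology -/
  [top : TopologicalSpace C]
  /-- continuity of multiplication -/
  [continuousMul : ContinuousMul C]
  /-- the submonoid `C⃗` -/
  pos : Submonoid C
  /-- `C ≅ 𝒪_ℂ^▷` as topological monoids -/
  exists_iso : ∃ e : C ≃* complexIntegralMonoid, Continuous e ∧ Continuous e.symm
  /-- `C^× × C⃗ → C`, `(u, t) ↦ u·t`, is a homeomorphism (it is then an isomorphism of topological monoids) -/
  isHomeomorph_mul : IsHomeomorph (fun x : Cˣ × pos => (x.1 : C) * (x.2 : C))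

attribute [instance] TMMono.instMonoid TMMono.top TMMono.continuousMul

/-- a morphism of `TM⊢`: an isomorphism of topological monoids `C₁ ≅ C₂` inducing `C⃗₁ ≅ C⃗₂`.
[cite: MochizukiAbsTopIII2015, Def 5.6 (i) p. 134] -/
structure TMMono.Iso (M₁ M₂ : TMMono.{u}) : Type u where
  /-- the isomorphism of monoids -/
  toMulEquiv : M₁.C ≃* M₂.C
  /-- continuity -/
  continuous_toFun : Continuous toMulEquiv
  /-- continuity of the inverse -/
  continuous_invFun : Continuous toMulEquiv.symm
  /-- `C⃗₁` is carried onto `C⃗₂` -/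
  map_pos : toMulEquiv '' (M₁.pos : Set M₁.C) = M₂.pos

/-! ## Prop 5.8 (i)–(iii): the nonarchimedean outputs -/

/-- the profinite (topological) abelianization `G^ab = G / closure([G, G])`.
[cite: MochizukiAbsTopIII2015, Prop 5.8 (i) p. 139] -/
abbrev profiniteAbelianization (G : ProfiniteGrp.{u}) : Type u :=
  G ⧸ (commutator G).topologicalClosure

/-- OUTPUT DATA of the group-theoretic algorithms of Prop 5.8 (i)–(iii) at `G ∈ Ob(TG⊢)` (fields quote print):
(i) the invariants `p, f, e, m` (hence `p*`, `p^f`, `[k : ℚ_p] = e·f`, `p^m`) and the images of the embeddings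
`𝒪_k^▷ ↪ G^ab`, `k^× ↪ G^ab` of local class field theory; (ii) the `Γ⃗×_non`-diagram
`𝒪^×_k̄(G) ↪ k̄^×(G)`, `𝒪^×_k̄(G) → k~(G) ↪ (k̄^×)^pf(G)` (Def 5.4 (iii)) with its `G`-actions and the log-shell
`ℐ(G) ⊆ k~(G)^G`; (iii) `R_non(G) = (k^×(G)/𝒪^×_k(G))^∧` with Frobenius element `F(G)` ("corresponding to
`f_G·log(p_G)`") and the log-volume `μ^log(G) : M(k~(G)^G) → R_non(G)` normalised by
`μ^log(G)(ℐ(G)) = {-1 - m_G/f_G + e_G·log(p*_G)/log(p_G)}·F(G)`. [cite: MochizukiAbsTopIII2015, Prop 5.8 (i)–(iii) pp. 139–140] -/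
structure MonoAnalyticNonarch (G : ProfiniteGrp.{u}) : Type (u + 1) where
  /-- (i) `p_G, f_G, e_G, m_G` -/
  inv : MLFType
  /-- (i) the image of `𝒪_k^▷ ↪ G^ab` -/
  integralImage : Submonoid (profiniteAbelianization G)
  /-- (i) the image of `k^× ↪ G^ab` -/
  multImage : Subgroup (profiniteAbelianization G)
  /-- `𝒪_k^▷ ⊆ k^×` -/
  integralImage_le : integralImage ≤ multImage.toSubmonoid
  /-- (ii) `k̄^×(G)`, a topological group with continuous `G`-action -/
  kbarMul : Type u
  /-- group structure of `k̄^×(G)` -/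
  [instGroupKbar : CommGroup kbarMul]
  /-- topology of `k̄^×(G)` -/
  [topKbar : TopologicalSpace kbarMul]
  /-- the `G`-action on `k̄^×(G)` -/
  [actKbar : MulAction G kbarMul]
  /-- (ii) `𝒪^×_k̄(G) ⊆ k̄^×(G)`, a `G`-stable subgroup -/
  kbarUnits : Subgroup kbarMul
  /-- `𝒪^×_k̄(G)` is `G`-stable -/
  smul_mem_kbarUnits : ∀ (g : G) {x : kbarMul}, x ∈ kbarUnits → g • x ∈ kbarUnits
  /-- (ii) `k~(G) := (𝒪^×_k̄)^pf(G)`, an additive topological group with continuous `G`-action (considered in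
  `TS⊞`, "relative to the additive topological group structure of the field `k~`") -/
  shell : Type u
  /-- additive structure of `k~(G)` -/
  [instAddShell : AddCommGroup shell]
  /-- topology of `k~(G)` -/
  [topShell : TopologicalSpace shell]
  /-- the `G`-action on `k~(G)` by additive maps -/
  [actShell : DistribMulAction G shell]
  /-- (ii) the shell-arrow `𝒪^×_k̄(G) → k~(G)` (the natural map to the perfection; `G`-equivariant) -/
  shellArrow : kbarUnits → shell
  /-- equivariance of the shell-arrow -/
  shellArrow_smul : ∀ (g : G) (x : kbarUnits), shellArrow ⟨g • (x : kbarMul), smul_mem_kbarUnits g x.2⟩ =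
    g • shellArrow x
  /-- (ii) the log-shell `ℐ(G) = (p*_G)⁻¹ · ℐ*` as a subset of the `G`-invariants `k~(G)^G` -/
  logShell : Set shell
  /-- `ℐ(G)` consists of `G`-invariants -/
  smul_eq_of_mem_logShell : ∀ (g : G) {x : shell}, x ∈ logShell → g • x = x
  /-- (iii) `R_non(G)` with its Frobenius element `F(G)` -/
  R : RLine.{u}
  /-- (iii) the log-volume `μ^log(G)` on subsets of `k~(G)^G` (meaningful on `M(k~(G)^G)` = compact opens) -/
  logVol : Set shell → R.carrier
  /-- (iii) the normalisation `μ^log(G)(ℐ(G)) = {-1 - m_G/f_G + e_G·log(p*_G)/log(p_G)} · F(G)` -/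
  logVol_logShell : logVol logShell = inv.logShellCoeff • R.frob

attribute [instance] MonoAnalyticNonarch.instGroupKbar MonoAnalyticNonarch.topKbar
  MonoAnalyticNonarch.actKbar MonoAnalyticNonarch.instAddShell MonoAnalyticNonarch.topShell
  MonoAnalyticNonarch.actShell

namespace MonoAnalyticNonarch

variable {G : ProfiniteGrp.{u}} (A : MonoAnalyticNonarch G)

/-- `μ^log(G)` read in `ℝ` through `R_non(G) ≅ ℝ`, `F(G) ↦ f_G·log(p_G)` (Prop 5.8 (iii)).
[cite: MochizukiAbsTopIII2015, Prop 5.8 (iii) p. 140] -/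
noncomputable def realLogVol (S : Set A.shell) : ℝ := A.R.toReal A.inv.frobeniusWeight (A.logVol S)

/-- In real terms the normalisation reads `μ^log(G)(ℐ(G)) = logShellCoeff · (f·log p) = e·f·log p* - (f+m)·log p`
(`MLFType.logShellLogVolume`). [cite: MochizukiAbsTopIII2015, Prop 5.8 (iii) p. 140] -/
theorem realLogVol_logShell : A.realLogVol A.logShell = A.inv.logShellLogVolume := by
  unfold realLogVol RLine.toReal MLFType.logShellLogVolume
  congr 1
  have h := A.R.coord_smul_frob (A.logVol A.logShell)
  rw [A.logVol_logShell] at h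
  have h' := sub_eq_zero.2 h
  rw [← sub_smul, smul_eq_zero] at h'
  rcases h' with h' | h'
  · rw [A.logVol_logShell]; linarith
  · exact absurd h' A.R.frob_ne_zero

end MonoAnalyticNonarch

/-- **Prop 5.8 (i)–(iii)** as an INTERFACE (hypothesis structure, not a `Prop`: an `∃`-statement without the
comparison to `k` would be vacuous): "a functorial [relative to `TG⊢`, contravariantly via the Verlagerung on
abelianizations] group-theoretic algorithm" `G ↦ MonoAnalyticNonarch G` on `Ob(TG⊢)`, with the
isomorphism-invariance of the reconstructed invariants. The COMPARISON with the invariants / class field theory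
of `k` when `G = G_k` ([AbsAnab] Prop 1.2.1, quoted by Prop 5.8 (i)) is abc-iut-L4-t4's fact and is not
restated here (TODO-merge abc-iut-L4-t4). Consumers take a term of this structure as a hypothesis.
[cite: MochizukiAbsTopIII2015, Prop 5.8 (i) p. 139] -/
structure MonoAnalyticNonarchAlgorithm : Type (u + 1) where
  /-- the output of the algorithm at `G ∈ Ob(TG⊢)` -/
  out : ∀ G : ProfiniteGrp.{u}, IsMLFGaloisType G → MonoAnalyticNonarch G
  /-- functoriality shadow: isomorphic groups have the same reconstructed invariants `p, f, e, m` -/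
  inv_eq_of_iso : ∀ (G H : ProfiniteGrp.{u}) (hG : IsMLFGaloisType G) (hH : IsMLFGaloisType H),
    Nonempty (G ≃ₜ* H) → (out G hG).inv = (out H hH).inv

/-! ## Prop 5.8 (iv)–(vi): the archimedean outputs -/

/-- OUTPUT DATA of the algorithms of Prop 5.8 (iv)–(vi) at `G = (C, C⃗) ∈ Ob(TM⊢)` (fields quote print):
(iv) the pointed universal covering `C~ → C^×` "regarded as a topological group isomorphic to `ℝ`" (modelled
as a real line, cf. `RLine`), `k~(G) := C~ × C~`, `k^×(G) := C^× × C~`, the monoid `Seg(G) ≅ ℝ_{≥0}` of compact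
line segments of `C~` up to translation; (v) the log-shell
`ℐ(G) = {(a·x, b·x) | x ∈ ℐ_{C~}; a, b ∈ ℝ; a² + b² = 1} ⊆ k~(G)` where `ℐ_{C~}` is "the unique compact line
segment on `C~` invariant under `±1` that maps bijectively, except for its endpoints, to `C^×`";
(vi) `R_arc(G) := Seg(G)^gp` with Frobenius element `F(G)` = the class of a segment mapping bijectively except
for its endpoints onto `C^×` ("corresponding to `2π`"), `𝒪^×_{k~(G)} = {(a·x, b·x) | x ∈ ∂ℐ_{C~}; a² + b² = π⁻²}`,
and radial/angular log-volumes normalised by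
`μ^log(G)(ℐ(G)) = μ̆^log(G)(𝒪^×_{k~(G)}) - log(2)·F(G)/2π = log(π)·F(G)/2π`.
[cite: MochizukiAbsTopIII2015, Prop 5.8 (iv)–(vi) pp. 140–141] -/
structure MonoAnalyticArch (M : TMMono.{u}) : Type (u + 1) where
  /-- (iv) `C~`, the universal covering of `C^×`, a real line -/
  cover : Type u
  /-- additive structure of `C~` -/
  [instAddCover : AddCommGroup cover]
  /-- `C~ ≅ ℝ`: real line structure -/
  [instModuleCover : Module ℝ cover]
  /-- topology of `C~` -/
  [topCover : TopologicalSpace cover]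
  /-- (iv) the covering map `C~ → C^×` (a continuous surjective homomorphism onto `C^× ≅ S¹`) -/
  coverMap : cover → M.Cˣ
  /-- `coverMap` is additive-to-multiplicative -/
  coverMap_add : ∀ x y, coverMap (x + y) = coverMap x * coverMap y
  /-- `coverMap` is surjective -/
  coverMap_surjective : Function.Surjective coverMap
  /-- (v) `ℐ_{C~}`: the compact segment invariant under `±1` mapping bijectively, except for its endpoints, onto `C^×` -/
  coreSeg : Set cover
  /-- `ℐ_{C~}` is symmetric -/
  neg_mem_coreSeg : ∀ {x}, x ∈ coreSeg → -x ∈ coreSeg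
  /-- `ℐ_{C~}` is a segment `[-x₀, x₀]` -/
  exists_endpoint : ∃ x₀ : cover, coreSeg = {x | ∃ t : ℝ, t ∈ Set.Icc (-1 : ℝ) 1 ∧ x = t • x₀} ∧
    Set.InjOn coverMap {x | ∃ t : ℝ, t ∈ Set.Ioo (-1 : ℝ) 1 ∧ x = t • x₀} ∧ coverMap x₀ = coverMap (-x₀)
  /-- (vi) `R_arc(G) = Seg(G)^gp` with Frobenius element `F(G)` -/
  R : RLine.{u}
  /-- (vi) radial log-volume `μ^log(G) : M(k~(G)) → R_arc(G)` -/
  radLogVol : Set (cover × cover) → R.carrier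
  /-- (vi) angular log-volume `μ̆^log(G) : M̆(k~(G)) → R_arc(G)` -/
  angLogVol : Set (cover × cover) → R.carrier

attribute [instance] MonoAnalyticArch.instAddCover MonoAnalyticArch.instModuleCover MonoAnalyticArch.topCover

namespace MonoAnalyticArch

variable {M : TMMono.{u}} (A : MonoAnalyticArch M)

/-- (iv) `k~(G) := C~ × C~`. [cite: MochizukiAbsTopIII2015, Prop 5.8 (iv) p. 140] -/
abbrev shell : Type u := A.cover × A.cover

/-- (v) the log-shell `ℐ(G) := {(a·x, b·x) | x ∈ ℐ_{C~}; a, b ∈ ℝ; a² + b² = 1} ⊆ k~(G)`.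
[cite: MochizukiAbsTopIII2015, Prop 5.8 (v) p. 140] -/
def logShell : Set A.shell :=
  {z | ∃ (a b : ℝ) (x : A.cover), x ∈ A.coreSeg ∧ a ^ 2 + b ^ 2 = 1 ∧ z = (a • x, b • x)}

/-- `∂ℐ_{C~}`: the endpoints of the core segment (the `x ∈ ℐ_{C~}` with `coverMap x = coverMap (-x)`, `x ≠ 0`,
i.e. `±x₀`). [cite: MochizukiAbsTopIII2015, Prop 5.8 (vi) p. 141] -/
def coreBoundary : Set A.cover := {x | x ∈ A.coreSeg ∧ x ≠ 0 ∧ A.coverMap x = A.coverMap (-x)}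

/-- (vi) `𝒪^×_{k~(G)} := {(a·x, b·x) | x ∈ ∂ℐ_{C~}; a, b ∈ ℝ; a² + b² = π⁻²} ⊆ k~(G)`.
[cite: MochizukiAbsTopIII2015, Prop 5.8 (vi) p. 141] -/
def units : Set A.shell :=
  {z | ∃ (a b : ℝ) (x : A.cover), x ∈ A.coreBoundary ∧ a ^ 2 + b ^ 2 = (Real.pi ^ 2)⁻¹ ∧ z = (a • x, b • x)}

/-- (vi) the normalisation, read in `ℝ` via `R_arc(G) ≅ ℝ`, `F(G) ↦ 2π`:
`μ^log(G)(ℐ(G)) = μ̆^log(G)(𝒪^×_{k~(G)}) - log 2` and `= log π` (cf. `ComplexLogShell.logShellRadialLogVolume_eq`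
for the `ℂ`-model). [cite: MochizukiAbsTopIII2015, Prop 5.8 (vi) p. 141] -/
def IsNormalized : Prop :=
  A.R.toReal (2 * Real.pi) (A.radLogVol A.logShell) = A.R.toReal (2 * Real.pi) (A.angLogVol A.units) - Real.log 2 ∧
    A.R.toReal (2 * Real.pi) (A.radLogVol A.logShell) = Real.log Real.pi

end MonoAnalyticArch

/-- **Prop 5.8 (iv)–(vi)** as an INTERFACE (hypothesis structure): "a functorial [relative to `TM⊢`] algorithm"
`G ↦ MonoAnalyticArch G` on `Ob(TM⊢)` satisfying the printed normalisation. Consumers take a term of this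
structure as a hypothesis; the `ℂ`-model (`LogShells.lean`, `ComplexLogShell`) shows the normalisation is
consistent. [cite: MochizukiAbsTopIII2015, Prop 5.8 (iv)–(vi) pp. 140–141] -/
structure MonoAnalyticArchAlgorithm : Type (u + 1) where
  /-- the output of the algorithm at `G ∈ Ob(TM⊢)` -/
  out : ∀ M : TMMono.{u}, MonoAnalyticArch M
  /-- the normalisation of Prop 5.8 (vi) holds -/
  isNormalized : ∀ M, (out M).IsNormalized

end Literature.AnabelianGeometry.AbsoluteAnabelian
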